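import Literature.Geometry.Kaehler.ComplexTorusHodgeGroupProductHodgeGeneralFactor
import Literature.Geometry.Kaehler.ComplexTorusHodgeGroupSpecialLinearExample
import Literature.NumberTheory.Automorphic.SpecialLinearZConnected
import HarnessLib

/-!
# The DIMENSION CRITERION for Hodge-generality: a complex torus `X` of dimension `g ≥ 1` has `Hg(X) = SL(H₁(X, ℚ))`
# iff `dim Hg(X) = (2g)² − 1` iff `Lie Hg(X)(ℂ) = 𝔰𝔩(V_ℂ)`; products `X₁ × X₂` and abelian varieties of dimension
# `≥ 2` are never Hodge-general

Layer `Literature/Geometry/Kaehler`, namespace `Literature.Geometry.Kaehler.ComplexTorus`; lane `lit-hodgefound`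
(Track 2 foundations library), Layer A3/A4; prover seat `lit-hodgefound-p17` (generation 39, self-proposed row g39-#2 —
the Hodge consumer of g39-#1 `Literature/NumberTheory/Automorphic/SpecialLinearZConnected` («`SL_n ≤ GL_n` is closed,
connected, of dimension `n² − 1`; a connected `H ≤ SL_n` with `dim H = n² − 1` or `Lie(H) = 𝔰𝔩ₙ` is `SL_n`»), i.e. the
CONVERSE of g38-#6b `ComplexTorusHodgeGroupProductHodgeGeneralFactor.zdim_map_toGL_hodgeGroupC_eq_of_eq_top`).
THEOREMS ONLY (no definition, no instance, no notation, no named fact; D-0026 net debt 0). "Hodge-general" is the tree's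
`hodgeGroupC Φ = ⊤` (`Hg(X)(ℂ) = SL(V_ℂ)`), equivalently `hodgeGroup Φ = ⊤` (`hodgeGroupC_eq_top_iff_hodgeGroup_eq_top`).

## Sources, verbatim

* B. Moonen, Yu. G. Zarhin [MoonenZarhin1999LowDim] (held `paper:arxiv-math_9901113`), §1 (p0002 L108): "We can define
  it by `Hg(X) = MT(X) ∩ SL(V)`" (`Hg(X)` is a connected algebraic subgroup of `SL(V)`); §3 (3.1) (p0006 L25–L60):
  "`hg(X₁ × X₂) ≅ 𝔤₁ ⊕ 𝔤₂ ⊕ Γ_φ`" with `hg(X₁ × X₂) ⊆ hg(X₁) × hg(X₂)`.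
* H. Imai [Imai1976HodgeGroups], §2 Proposition (p. 370 L11–L16): "`Hg(A₁ × A₂) ⊆ Hg(A₁) × Hg(A₂)`"; §3 Remarks
  (p. 370 L29–L30, L44–L54): "as `dim Hg(E₁ × E₂) ≥ dim Hg(E₁)` […] we have the desired isomorphism by dimension".
* H. Lange [Lange2023AbelianVarietiesComplex], §7.2.1 Prop. 7.2.3 ("`Hg(X) ⊆ Sp(V, E)`" for a polarised `X`), §7.3.1,
  proof of Prop. 7.3.2 (p0337): "`𝔥𝔤(X_J)` is a proper Lie subalgebra of `𝔰𝔭(V, E)`" unless `Hg(X_J)` is the whole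
  group.
* T. A. Springer [Springer1998], 1.8.2 (closed irreducible subvariety of the same dimension is everything), 2.2.2 (1)
  (`SL_n` is connected), 4.4.6 (`dim L(G) = dim G`), 4.4.11 (1) (`L(SL_n) = 𝔰𝔩ₙ`) — the tree's `SpecialLinearZConnected`.
* J. E. Humphreys [Humphreys1972], §1.2 (`dim 𝔰𝔩ₙ = n² − 1`), §19.2 (`𝔰𝔩ₙ` simple).

## What is proved

* §1 THE CRITERION (`X` of dimension `g ≥ 1`, `2g = |ι|`): **`hodgeGroupC_eq_top_iff_zdim_eq`** (`Hg(X)(ℂ) = SL(V_ℂ) ⟺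
  dim Hg(X) = (2g)² − 1`), `hodgeGroupC_ne_top_iff_zdim_lt`, **`hodgeGroupC_eq_top_iff_finrank_lieAlgebraGL_eq`**,
  **`hodgeGroupC_eq_top_iff_lieSubalgebraGL_eq_sl`** (`⟺ Lie Hg(X)(ℂ) = 𝔰𝔩(V_ℂ)`, the LAG tangent algebra),
  `hodgeGroupC_eq_top_of_lieAlgebraGL_eq_ker_trace`, the real-points forms `hodgeGroup_eq_top_iff_zdim_eq`,
  `hodgeGroup_eq_top_iff_lieSubalgebraGL_eq_sl`, and the first bridge between the lane's analytic Lie algebra and the LAG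
  tangent algebra: **`hodgeGroupLie_eq_sl_iff_lieSubalgebraGL_eq_sl`** (`𝔥𝔤_ℝ = 𝔰𝔩(V_ℝ) ⟺ Lie Hg(X)(ℂ) = 𝔰𝔩(V_ℂ)`).
* §2 CONSEQUENCES at full dimension: `isSimple_lieSubalgebraGL_map_toGL_hodgeGroupC_of_zdim_eq` (simple Lie algebra),
  `commutator_hodgeGroupC_eq_self_of_zdim_eq` (perfect), `mumfordTateGroupC_eq_top_of_zdim_eq` (`MT(X)(ℂ) = GL(V_ℂ)`),
  `endAlgRat_eq_bot_of_zdim_eq` (`End_ℚ(X) = ℚ`), `not_isAbelianVariety_of_zdim_eq` (`g ≥ 2`: no polarisation), and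
  conversely **`IsAbelianVariety.zdim_map_toGL_hodgeGroupC_lt`** (`dim Hg(X) < (2g)² − 1` for every abelian variety of
  dimension `g ≥ 2`), `zdim_map_toGL_hodgeGroupC_lt_of_endAlgRat_ne_bot`.
* §3 PRODUCTS ARE NEVER HODGE-GENERAL (`X₁`, `X₂` of positive dimension): **`zdim_map_toGL_hodgeGroupC_prod_lt`**
  (`dim Hg(X₁ × X₂) ≤ dim Hg(X₁) + dim Hg(X₂) ≤ (2g₁)² + (2g₂)² − 2 < (2g₁ + 2g₂)² − 1`), **`hodgeGroupC_prod_ne_top`**,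
  `hodgeGroup_prod_ne_top`, `lieSubalgebraGL_map_toGL_hodgeGroupC_prod_ne_sl`, `finrank_lieAlgebraGL_map_toGL_hodgeGroupC_prod_lt`.
* §4 ONE-DIMENSIONAL TORI: `zdim_map_toGL_hodgeGroupC_le_three`, **`zdim_map_toGL_hodgeGroupC_eq_three_iff_endAlgRat_eq_bot`**
  (`dim Hg(E) = 3 ⟺ End_ℚ(E) = ℚ`), `zdim_map_toGL_hodgeGroupC_lt_three_iff_endAlgRat_ne_bot` (complex multiplication),
  and for `E_τ = ℂ/(ℤτ + ℤ)`: `zdim_map_toGL_hodgeGroupC_ellipticPeriod_eq_three_iff`.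

## References

* [MoonenZarhin1999LowDim] B. Moonen, Yu. G. Zarhin, Math. Ann. 315 (1999), §1, §3 (3.1).
* [Imai1976HodgeGroups] H. Imai, Kōdai Math. Sem. Rep. 27 (1976), §2 Proposition, §3 Remarks (p. 370).
* [Lange2023AbelianVarietiesComplex] H. Lange, *Abelian Varieties over the Complex Numbers* (2023), §7.2.1 Prop. 7.2.3,
  §7.2.2 Prop. 7.2.5, §7.3.1 Prop. 7.3.2.
* [Springer1998] T. A. Springer, *Linear Algebraic Groups*, 2nd ed. (1998), 1.8.2, 2.2.2 (1), 4.4.6, 4.4.11 (1).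
* [Humphreys1972] J. E. Humphreys, *Introduction to Lie Algebras and Representation Theory* (1972), §1.2, §19.2.
-/

noncomputable section

open Matrix Module

namespace Literature.Geometry.Kaehler

namespace ComplexTorus

open Literature.NumberTheory.Automorphic (IsZConnected lieAlgebraGL lieSubalgebraGL eq_top_iff_zdim_map_toGL_eq
  ne_top_iff_zdim_map_toGL_lt eq_top_iff_finrank_lieAlgebraGL_map_toGL_eq eq_top_iff_lieSubalgebraGL_map_toGL_eq_sl
  eq_top_of_isZConnected_map_toGL_of_zdim_eq eq_range_toGL_of_lieAlgebraGL_eq_ker_trace map_toGL_top_eq_range)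

/-! ## §1 The criterion -/

section Criterion

variable {ι : Type*} [Fintype ι] [DecidableEq ι] {E : Type*} [NormedAddCommGroup E] [NormedSpace ℂ E]
  (Φ : (ι → ℝ) ≃L[ℝ] E)

/-- **THE DIMENSION CRITERION: `Hg(X)(ℂ) = SL(V_ℂ) ⟺ dim Hg(X) = (2g)² − 1`** (`X` of dimension `g ≥ 1`; `Hg(X)(ℂ)` is a
connected closed subgroup of the connected `SL(V_ℂ)`, of dimension `(2g)² − 1`, and a closed irreducible subvariety of
the same dimension is everything). [cite: MoonenZarhin1999LowDim, §1 (p0002 L108)] [cite: Springer1998, 1.8.2 and 2.2.2 (1)]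
[cite: Imai1976HodgeGroups, §3 Remarks (p. 370 L44–L54)] -/
theorem hodgeGroupC_eq_top_iff_zdim_eq [Nonempty ι] :
    hodgeGroupC Φ = ⊤ ↔ (isZConnected_map_toGL_hodgeGroupC Φ).zdim = Fintype.card ι ^ 2 - 1 :=
  eq_top_iff_zdim_map_toGL_eq (isZConnected_map_toGL_hodgeGroupC Φ)

variable {Φ} in
/-- `dim Hg(X) = (2g)² − 1 ⟹ Hg(X)(ℂ) = SL(V_ℂ)`. [cite: Springer1998, 1.8.2 and 2.2.2 (1)] [cite: MoonenZarhin1999LowDim, §1 (p0002 L108)] -/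
theorem hodgeGroupC_eq_top_of_zdim_eq [Nonempty ι]
    (h : (isZConnected_map_toGL_hodgeGroupC Φ).zdim = Fintype.card ι ^ 2 - 1) : hodgeGroupC Φ = ⊤ :=
  (hodgeGroupC_eq_top_iff_zdim_eq Φ).2 h

/-- **`Hg(X)(ℂ) ≠ SL(V_ℂ) ⟺ dim Hg(X) < (2g)² − 1`.** [cite: Springer1998, 1.8.2 and 2.2.2 (1)] [cite: MoonenZarhin1999LowDim, §1 (p0002 L108)] -/
theorem hodgeGroupC_ne_top_iff_zdim_lt [Nonempty ι] :
    hodgeGroupC Φ ≠ ⊤ ↔ (isZConnected_map_toGL_hodgeGroupC Φ).zdim < Fintype.card ι ^ 2 - 1 :=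
  ne_top_iff_zdim_map_toGL_lt (isZConnected_map_toGL_hodgeGroupC Φ)

variable {Φ} in
/-- `Hg(X)(ℂ) ≠ SL(V_ℂ) ⟹ dim Hg(X) < (2g)² − 1`. [cite: Springer1998, 1.8.2 and 2.2.2 (1)] -/
theorem zdim_map_toGL_hodgeGroupC_lt_of_ne_top [Nonempty ι] (h : hodgeGroupC Φ ≠ ⊤) :
    (isZConnected_map_toGL_hodgeGroupC Φ).zdim < Fintype.card ι ^ 2 - 1 :=
  (hodgeGroupC_ne_top_iff_zdim_lt Φ).1 h

/-- **`Hg(X)(ℂ) = SL(V_ℂ) ⟺ dim_ℂ Lie Hg(X)(ℂ) = (2g)² − 1`.** [cite: Springer1998, 4.4.6 and 1.8.2] [cite: Humphreys1972, §1.2] -/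
theorem hodgeGroupC_eq_top_iff_finrank_lieAlgebraGL_eq [Nonempty ι] :
    hodgeGroupC Φ = ⊤ ↔
      Module.finrank ℂ (lieAlgebraGL ((hodgeGroupC Φ).map Matrix.SpecialLinearGroup.toGL)) = Fintype.card ι ^ 2 - 1 :=
  eq_top_iff_finrank_lieAlgebraGL_map_toGL_eq (isZConnected_map_toGL_hodgeGroupC Φ)

variable {Φ} in
/-- `dim_ℂ Lie Hg(X)(ℂ) = (2g)² − 1 ⟹ Hg(X)(ℂ) = SL(V_ℂ)`. [cite: Springer1998, 4.4.6 and 1.8.2] -/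
theorem hodgeGroupC_eq_top_of_finrank_lieAlgebraGL_eq [Nonempty ι]
    (h : Module.finrank ℂ (lieAlgebraGL ((hodgeGroupC Φ).map Matrix.SpecialLinearGroup.toGL)) = Fintype.card ι ^ 2 - 1) :
    hodgeGroupC Φ = ⊤ :=
  (hodgeGroupC_eq_top_iff_finrank_lieAlgebraGL_eq Φ).2 h

/-- **`Hg(X)(ℂ) = SL(V_ℂ) ⟺ Lie Hg(X)(ℂ) = 𝔰𝔩(V_ℂ)`** (the LAG tangent algebra `lieSubalgebraGL`, Mathlib's
`LieAlgebra.SpecialLinear.sl ι ℂ`): connected closed subgroups of `SL(V_ℂ)` with the Lie algebra of `SL(V_ℂ)` are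
`SL(V_ℂ)`. [cite: Springer1998, 4.4.6 and 4.4.11 (1)] [cite: MoonenZarhin1999LowDim, §1 (p0002 L108)] -/
theorem hodgeGroupC_eq_top_iff_lieSubalgebraGL_eq_sl [Nonempty ι] :
    hodgeGroupC Φ = ⊤ ↔
      lieSubalgebraGL ((hodgeGroupC Φ).map Matrix.SpecialLinearGroup.toGL) = LieAlgebra.SpecialLinear.sl ι ℂ :=
  eq_top_iff_lieSubalgebraGL_map_toGL_eq_sl (isZConnected_map_toGL_hodgeGroupC Φ)

variable {Φ} in
/-- `Lie Hg(X)(ℂ) = 𝔰𝔩(V_ℂ) ⟹ Hg(X)(ℂ) = SL(V_ℂ)`. [cite: Springer1998, 4.4.6 and 4.4.11 (1)] -/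
theorem hodgeGroupC_eq_top_of_lieSubalgebraGL_eq_sl [Nonempty ι]
    (h : lieSubalgebraGL ((hodgeGroupC Φ).map Matrix.SpecialLinearGroup.toGL) = LieAlgebra.SpecialLinear.sl ι ℂ) :
    hodgeGroupC Φ = ⊤ :=
  (hodgeGroupC_eq_top_iff_lieSubalgebraGL_eq_sl Φ).2 h

variable {Φ} in
/-- `Lie Hg(X)(ℂ) = ker tr` (as subspaces of `𝔤𝔩(V_ℂ)`) ⟹ `Hg(X)(ℂ) = SL(V_ℂ)`. [cite: Springer1998, 4.4.6 and 4.4.11 (1)] -/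
theorem hodgeGroupC_eq_top_of_lieAlgebraGL_eq_ker_trace [Nonempty ι]
    (h : lieAlgebraGL ((hodgeGroupC Φ).map Matrix.SpecialLinearGroup.toGL) = LinearMap.ker (Matrix.traceLinearMap ι ℂ ℂ)) :
    hodgeGroupC Φ = ⊤ :=
  Subgroup.map_injective Matrix.SpecialLinearGroup.toGL_injective
    ((eq_range_toGL_of_lieAlgebraGL_eq_ker_trace (isZConnected_map_toGL_hodgeGroupC Φ) (Subgroup.map_le_range _ _) h).trans
      map_toGL_top_eq_range.symm)

/-- **Real points: `Hg(X)(ℝ) = SL(V_ℝ) ⟺ dim Hg(X) = (2g)² − 1`.** [cite: Lange2023AbelianVarietiesComplex, §7.2.1 (p. 329)]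
[cite: Springer1998, 1.8.2 and 2.2.2 (1)] -/
theorem hodgeGroup_eq_top_iff_zdim_eq [Nonempty ι] :
    hodgeGroup Φ = ⊤ ↔ (isZConnected_map_toGL_hodgeGroupC Φ).zdim = Fintype.card ι ^ 2 - 1 := by
  rw [← hodgeGroupC_eq_top_iff_hodgeGroup_eq_top, hodgeGroupC_eq_top_iff_zdim_eq]

variable {Φ} in
/-- `dim Hg(X) = (2g)² − 1 ⟹ Hg(X)(ℝ) = SL(V_ℝ)`. [cite: Springer1998, 1.8.2 and 2.2.2 (1)] -/
theorem hodgeGroup_eq_top_of_zdim_eq [Nonempty ι]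
    (h : (isZConnected_map_toGL_hodgeGroupC Φ).zdim = Fintype.card ι ^ 2 - 1) : hodgeGroup Φ = ⊤ :=
  (hodgeGroup_eq_top_iff_zdim_eq Φ).2 h

/-- Real points: `Hg(X)(ℝ) = SL(V_ℝ) ⟺ Lie Hg(X)(ℂ) = 𝔰𝔩(V_ℂ)`. [cite: Springer1998, 4.4.6 and 4.4.11 (1)]
[cite: Lange2023AbelianVarietiesComplex, §7.2.1 (p. 329)] -/
theorem hodgeGroup_eq_top_iff_lieSubalgebraGL_eq_sl [Nonempty ι] :
    hodgeGroup Φ = ⊤ ↔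
      lieSubalgebraGL ((hodgeGroupC Φ).map Matrix.SpecialLinearGroup.toGL) = LieAlgebra.SpecialLinear.sl ι ℂ := by
  rw [← hodgeGroupC_eq_top_iff_hodgeGroup_eq_top, hodgeGroupC_eq_top_iff_lieSubalgebraGL_eq_sl]

/-- **`𝔥𝔤_ℝ = 𝔰𝔩(V_ℝ) ⟺ Lie Hg(X)(ℂ) = 𝔰𝔩(V_ℂ)`** — the lane's analytic Lie algebra `hodgeGroupLie Φ` of `Hg(X)(ℝ)` and
the LAG tangent algebra of `Hg(X)(ℂ) ≤ GL(V_ℂ)` detect Hodge-generality together (both are equivalent to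
`Hg(X) = SL(V)`). [cite: Lange2023AbelianVarietiesComplex, §7.3.1, proof of Prop. 7.3.2 (p0337)] [cite: Springer1998, 4.4.6 and 4.4.11 (1)] -/
theorem hodgeGroupLie_eq_sl_iff_lieSubalgebraGL_eq_sl [Nonempty ι] :
    hodgeGroupLie Φ = LieAlgebra.SpecialLinear.sl ι ℝ ↔
      lieSubalgebraGL ((hodgeGroupC Φ).map Matrix.SpecialLinearGroup.toGL) = LieAlgebra.SpecialLinear.sl ι ℂ := by
  rw [← hodgeGroup_eq_top_iff_hodgeGroupLie_eq_sl, hodgeGroup_eq_top_iff_lieSubalgebraGL_eq_sl]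

/-- `𝔥𝔤_ℝ = 𝔰𝔩(V_ℝ) ⟺ dim Hg(X) = (2g)² − 1`. [cite: Lange2023AbelianVarietiesComplex, §7.3.1, proof of Prop. 7.3.2 (p0337)]
[cite: Springer1998, 4.4.6 and 1.8.2] -/
theorem hodgeGroupLie_eq_sl_iff_zdim_eq [Nonempty ι] :
    hodgeGroupLie Φ = LieAlgebra.SpecialLinear.sl ι ℝ ↔
      (isZConnected_map_toGL_hodgeGroupC Φ).zdim = Fintype.card ι ^ 2 - 1 := by
  rw [← hodgeGroup_eq_top_iff_hodgeGroupLie_eq_sl, hodgeGroup_eq_top_iff_zdim_eq]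

end Criterion

/-! ## §2 Consequences at full dimension; abelian varieties of dimension `≥ 2` fall short -/

section Consequences

variable {ι : Type*} [Fintype ι] [DecidableEq ι] {E : Type*} [NormedAddCommGroup E] [NormedSpace ℂ E]
  (Φ : (ι → ℝ) ≃L[ℝ] E)

variable {Φ} in
/-- **`dim Hg(X) = (2g)² − 1 ⟹ Lie Hg(X)(ℂ) = 𝔰𝔩_{2g}(ℂ)` is a simple Lie algebra.** [cite: Humphreys1972, §19.2]
[cite: Springer1998, 4.4.11 (1)] -/
theorem isSimple_lieSubalgebraGL_map_toGL_hodgeGroupC_of_zdim_eq [Nonempty ι]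
    (h : (isZConnected_map_toGL_hodgeGroupC Φ).zdim = Fintype.card ι ^ 2 - 1) (hι : 1 < Fintype.card ι) :
    LieAlgebra.IsSimple ℂ (lieSubalgebraGL ((hodgeGroupC Φ).map Matrix.SpecialLinearGroup.toGL)) :=
  isSimple_lieSubalgebraGL_map_toGL_hodgeGroupC_of_eq_top (hodgeGroupC_eq_top_of_zdim_eq h) hι

variable {Φ} in
/-- `dim Hg(X) = (2g)² − 1 ⟹ Hg(X)(ℂ)` is perfect. [cite: Gordon1997, §2.5.2 Corollary] [cite: Springer1998, 4.4.11 (1)] -/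
theorem commutator_hodgeGroupC_eq_self_of_zdim_eq [Nonempty ι]
    (h : (isZConnected_map_toGL_hodgeGroupC Φ).zdim = Fintype.card ι ^ 2 - 1) (hι : 1 < Fintype.card ι) :
    ⁅hodgeGroupC Φ, hodgeGroupC Φ⁆ = hodgeGroupC Φ :=
  commutator_hodgeGroupC_eq_self_of_eq_top (hodgeGroupC_eq_top_of_zdim_eq h) hι

variable {Φ} in
/-- **`dim Hg(X) = (2g)² − 1 ⟹ MT(X)(ℂ) = GL(V_ℂ)`.** [cite: Lange2023AbelianVarietiesComplex, §7.2.1 Remark 7.2.2 (2)]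
[cite: Springer1998, 1.8.2 and 2.2.2 (1)] -/
theorem mumfordTateGroupC_eq_top_of_zdim_eq [Nonempty ι]
    (h : (isZConnected_map_toGL_hodgeGroupC Φ).zdim = Fintype.card ι ^ 2 - 1) : mumfordTateGroupC Φ = ⊤ :=
  mumfordTateGroupC_eq_top_of_hodgeGroupC_eq_top Φ (hodgeGroupC_eq_top_of_zdim_eq h)

variable {Φ} in
/-- **`dim Hg(X) = (2g)² − 1 ⟹ End_ℚ(X) = ℚ`.** [cite: Lange2023AbelianVarietiesComplex, §7.2.2 Prop. 7.2.5]
[cite: Springer1998, 1.8.2 and 2.2.2 (1)] -/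
theorem endAlgRat_eq_bot_of_zdim_eq [Nonempty ι]
    (h : (isZConnected_map_toGL_hodgeGroupC Φ).zdim = Fintype.card ι ^ 2 - 1) : endAlgRat Φ = ⊥ :=
  endAlgRat_eq_bot_of_hodgeGroupLie_eq_sl Φ ((hodgeGroupLie_eq_sl_iff_zdim_eq Φ).2 h)

variable {Φ} in
/-- A non-scalar endomorphism (`End_ℚ(X) ≠ ℚ`: complex or real multiplication, …) forces `dim Hg(X) < (2g)² − 1`.
[cite: Lange2023AbelianVarietiesComplex, §7.2.2 Prop. 7.2.5] [cite: Springer1998, 1.8.2] -/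
theorem zdim_map_toGL_hodgeGroupC_lt_of_endAlgRat_ne_bot [Nonempty ι] (hE : endAlgRat Φ ≠ ⊥) :
    (isZConnected_map_toGL_hodgeGroupC Φ).zdim < Fintype.card ι ^ 2 - 1 :=
  (hodgeGroupC_ne_top_iff_zdim_lt Φ).1 fun h ↦ hE (endAlgRat_eq_bot_of_zdim_eq ((hodgeGroupC_eq_top_iff_zdim_eq Φ).1 h))

variable {Φ} in
/-- **A complex torus of dimension `g ≥ 2` with `dim Hg(X) = (2g)² − 1` is NOT an abelian variety** (`Hg(X) = SL(V)`
preserves no alternating form). [cite: Lange2023AbelianVarietiesComplex, §7.2.1 Prop. 7.2.3] [cite: Springer1998, 1.8.2 and 2.2.2 (1)] -/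
theorem not_isAbelianVariety_of_zdim_eq [Nonempty ι] [FiniteDimensional ℂ E]
    (h : (isZConnected_map_toGL_hodgeGroupC Φ).zdim = Fintype.card ι ^ 2 - 1) (hg : 2 ≤ finrank ℂ E) :
    ¬ IsAbelianVariety Φ :=
  not_isAbelianVariety_of_hodgeGroup_eq_top (hodgeGroup_eq_top_of_zdim_eq h) hg

variable {Φ} in
/-- **For an ABELIAN VARIETY of dimension `g ≥ 2`: `dim Hg(X) < (2g)² − 1`** (`Hg(X) ⊆ Sp(V, E) ⊊ SL(V)`).
[cite: Lange2023AbelianVarietiesComplex, §7.2.1 Prop. 7.2.3 and §7.3.1 proof of Prop. 7.3.2 (p0337)] [cite: Springer1998, 1.8.2] -/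
theorem IsAbelianVariety.zdim_map_toGL_hodgeGroupC_lt [Nonempty ι] [FiniteDimensional ℂ E] (hX : IsAbelianVariety Φ)
    (hg : 2 ≤ finrank ℂ E) : (isZConnected_map_toGL_hodgeGroupC Φ).zdim < Fintype.card ι ^ 2 - 1 :=
  (hodgeGroupC_ne_top_iff_zdim_lt Φ).1 fun h ↦
    hX.hodgeGroup_ne_top hg ((hodgeGroupC_eq_top_iff_hodgeGroup_eq_top Φ).1 h)

variable {Φ} in
/-- For an abelian variety of dimension `g ≥ 2`: `Lie Hg(X)(ℂ) ≠ 𝔰𝔩(V_ℂ)`. [cite: Lange2023AbelianVarietiesComplex, §7.3.1, proof of Prop. 7.3.2 (p0337)]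
[cite: Springer1998, 4.4.11 (1)] -/
theorem IsAbelianVariety.lieSubalgebraGL_map_toGL_hodgeGroupC_ne_sl [Nonempty ι] [FiniteDimensional ℂ E]
    (hX : IsAbelianVariety Φ) (hg : 2 ≤ finrank ℂ E) :
    lieSubalgebraGL ((hodgeGroupC Φ).map Matrix.SpecialLinearGroup.toGL) ≠ LieAlgebra.SpecialLinear.sl ι ℂ := fun h ↦
  hX.hodgeGroup_ne_top hg ((hodgeGroup_eq_top_iff_lieSubalgebraGL_eq_sl Φ).2 h)

end Consequences

/-! ## §3 Products of positive-dimensional tori are never Hodge-general -/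

section Product

variable {ι₁ ι₂ : Type*} [Fintype ι₁] [Fintype ι₂] [DecidableEq ι₁] [DecidableEq ι₂]
  {E₁ E₂ : Type*} [NormedAddCommGroup E₁] [NormedSpace ℂ E₁] [NormedAddCommGroup E₂] [NormedSpace ℂ E₂]
  (Φ₁ : (ι₁ → ℝ) ≃L[ℝ] E₁) (Φ₂ : (ι₂ → ℝ) ≃L[ℝ] E₂)

/-- `(a² − 1) + (b² − 1) < (a + b)² − 1` for positive `a`, `b` (the dimension count behind "a product is never
Hodge-general"). [cite: Humphreys1972, §1.2] -/
private theorem sq_sub_one_add_sq_sub_one_lt {a b : ℕ} (ha : 0 < a) (hb : 0 < b) :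
    a ^ 2 - 1 + (b ^ 2 - 1) < (a + b) ^ 2 - 1 := by
  have hsq : (a + b) ^ 2 = a ^ 2 + 2 * (a * b) + b ^ 2 := by ring
  have h1 : 1 ≤ a ^ 2 := Nat.one_le_pow _ _ ha
  have h2 : 1 ≤ b ^ 2 := Nat.one_le_pow _ _ hb
  have hab : 1 ≤ a * b := Nat.one_le_iff_ne_zero.2 (Nat.mul_ne_zero ha.ne' hb.ne')
  omega

/-- **`dim Hg(X₁ × X₂) < (2g₁ + 2g₂)² − 1`** for complex tori `X₁`, `X₂` of positive dimension:
`dim Hg(X₁ × X₂) ≤ dim Hg(X₁) + dim Hg(X₂) ≤ ((2g₁)² − 1) + ((2g₂)² − 1)` (`Hg(X₁ × X₂) ⊆ Hg(X₁) × Hg(X₂)`).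
[cite: Imai1976HodgeGroups, §2 Proposition (p. 370 L11–L16)] [cite: MoonenZarhin1999LowDim, §3 (3.1)] [cite: Humphreys1972, §1.2] -/
theorem zdim_map_toGL_hodgeGroupC_prod_lt [Nonempty ι₁] [Nonempty ι₂] :
    (isZConnected_map_toGL_hodgeGroupC (prodPeriod Φ₁ Φ₂)).zdim < Fintype.card (ι₁ ⊕ ι₂) ^ 2 - 1 := by
  have h := zdim_map_toGL_hodgeGroupC_prod_le_add Φ₁ Φ₂
  have h1 := zdim_map_toGL_hodgeGroupC_le Φ₁
  have h2 := zdim_map_toGL_hodgeGroupC_le Φ₂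
  have h3 := sq_sub_one_add_sq_sub_one_lt (Fintype.card_pos (α := ι₁)) (Fintype.card_pos (α := ι₂))
  rw [Fintype.card_sum]
  omega

/-- **A PRODUCT OF TWO COMPLEX TORI OF POSITIVE DIMENSION IS NEVER HODGE-GENERAL: `Hg(X₁ × X₂)(ℂ) ≠ SL(V₁ ⊕ V₂)_ℂ`**
(by dimension; equivalently, `Hg(X₁ × X₂) ⊆ Hg(X₁) × Hg(X₂)` is a proper subgroup of `SL(V₁ ⊕ V₂)`).
[cite: Imai1976HodgeGroups, §2 Proposition (p. 370 L11–L16)] [cite: MoonenZarhin1999LowDim, §3 (3.1)] [cite: Springer1998, 1.8.2] -/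
theorem hodgeGroupC_prod_ne_top [Nonempty ι₁] [Nonempty ι₂] : hodgeGroupC (prodPeriod Φ₁ Φ₂) ≠ ⊤ :=
  (hodgeGroupC_ne_top_iff_zdim_lt _).2 (zdim_map_toGL_hodgeGroupC_prod_lt Φ₁ Φ₂)

/-- Real points: `Hg(X₁ × X₂)(ℝ) ≠ SL(V₁ ⊕ V₂)_ℝ` for `X₁`, `X₂` of positive dimension.
[cite: Imai1976HodgeGroups, §2 Proposition (p. 370 L11–L16)] [cite: MoonenZarhin1999LowDim, §3 (3.1)] -/
theorem hodgeGroup_prod_ne_top [Nonempty ι₁] [Nonempty ι₂] : hodgeGroup (prodPeriod Φ₁ Φ₂) ≠ ⊤ := fun h ↦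
  hodgeGroupC_prod_ne_top Φ₁ Φ₂ ((hodgeGroupC_eq_top_iff_hodgeGroup_eq_top _).2 h)

/-- `𝔥𝔤_ℝ(X₁ × X₂) ≠ 𝔰𝔩(V₁ ⊕ V₂)_ℝ` for `X₁`, `X₂` of positive dimension. [cite: MoonenZarhin1999LowDim, §3 (3.1)]
[cite: Lange2023AbelianVarietiesComplex, §7.3.1, proof of Prop. 7.3.2 (p0337)] -/
theorem hodgeGroupLie_prod_ne_sl [Nonempty ι₁] [Nonempty ι₂] :
    hodgeGroupLie (prodPeriod Φ₁ Φ₂) ≠ LieAlgebra.SpecialLinear.sl (ι₁ ⊕ ι₂) ℝ := fun h ↦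
  hodgeGroup_prod_ne_top Φ₁ Φ₂ ((hodgeGroup_eq_top_iff_hodgeGroupLie_eq_sl _).2 h)

/-- `Lie Hg(X₁ × X₂)(ℂ) ≠ 𝔰𝔩(V₁ ⊕ V₂)_ℂ` for `X₁`, `X₂` of positive dimension. [cite: MoonenZarhin1999LowDim, §3 (3.1)]
[cite: Springer1998, 4.4.11 (1)] -/
theorem lieSubalgebraGL_map_toGL_hodgeGroupC_prod_ne_sl [Nonempty ι₁] [Nonempty ι₂] :
    lieSubalgebraGL ((hodgeGroupC (prodPeriod Φ₁ Φ₂)).map Matrix.SpecialLinearGroup.toGL) ≠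
      LieAlgebra.SpecialLinear.sl (ι₁ ⊕ ι₂) ℂ := fun h ↦
  hodgeGroupC_prod_ne_top Φ₁ Φ₂ (hodgeGroupC_eq_top_of_lieSubalgebraGL_eq_sl h)

/-- `dim_ℂ Lie Hg(X₁ × X₂)(ℂ) < (2g₁ + 2g₂)² − 1` for `X₁`, `X₂` of positive dimension. [cite: MoonenZarhin1999LowDim, §3 (3.1)]
[cite: Springer1998, 4.4.6] [cite: Humphreys1972, §1.2] -/
theorem finrank_lieAlgebraGL_map_toGL_hodgeGroupC_prod_lt [Nonempty ι₁] [Nonempty ι₂] :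
    Module.finrank ℂ (lieAlgebraGL ((hodgeGroupC (prodPeriod Φ₁ Φ₂)).map Matrix.SpecialLinearGroup.toGL)) <
      Fintype.card (ι₁ ⊕ ι₂) ^ 2 - 1 := by
  rw [(isZConnected_map_toGL_hodgeGroupC (prodPeriod Φ₁ Φ₂)).finrank_lieAlgebraGL_eq.2]
  exact zdim_map_toGL_hodgeGroupC_prod_lt Φ₁ Φ₂

/-- `MT`-form of the product bound is one-sided: `dim Hg(X₁ × X₂) < (2g₁ + 2g₂)² − 1` with `dim Hg(X₁ × X₂) ≥ dim Hg(Xᵢ)`;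
in particular a product with a Hodge-general factor `X₁` has `(2g₁)² − 1 ≤ dim Hg(X₁ × X₂) < (2g₁ + 2g₂)² − 1`.
[cite: Imai1976HodgeGroups, §3 Remarks (p. 370 L29–L30)] [cite: MoonenZarhin1999LowDim, §3 (3.1)] -/
theorem zdim_map_toGL_hodgeGroupC_prod_mem_Ico_of_eq_top [Nonempty ι₁] [Nonempty ι₂] (h₁ : hodgeGroupC Φ₁ = ⊤) :
    (isZConnected_map_toGL_hodgeGroupC (prodPeriod Φ₁ Φ₂)).zdim ∈
      Set.Ico (Fintype.card ι₁ ^ 2 - 1) (Fintype.card (ι₁ ⊕ ι₂) ^ 2 - 1) :=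
  ⟨(zdim_map_toGL_hodgeGroupC_eq_of_eq_top h₁).symm.le.trans (zdim_map_toGL_hodgeGroupC_le_prod_left Φ₁ Φ₂),
    zdim_map_toGL_hodgeGroupC_prod_lt Φ₁ Φ₂⟩

end Product

/-! ## §4 One-dimensional tori: `dim Hg(E) = 3` iff no complex multiplication -/

section DimensionOne

/-- `dim Hg(E) ≤ 3` for every one-dimensional complex torus `E = ℂ/Ψ(ℤ²)`. [cite: Imai1976HodgeGroups, §2 (p. 368)]
[cite: Springer1998, 4.4.6 and 4.4.11 (1)] -/
theorem zdim_map_toGL_hodgeGroupC_le_three (Ψ : (Fin 2 → ℝ) ≃L[ℝ] ℂ) :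
    (isZConnected_map_toGL_hodgeGroupC Ψ).zdim ≤ 3 := by
  have h := zdim_map_toGL_hodgeGroupC_le Ψ
  simpa using h

/-- **`dim Hg(E) = 3 ⟺ End_ℚ(E) = ℚ`** for a one-dimensional complex torus (`Hg(E) = SL₂` iff `E` is not of CM-type).
[cite: Imai1976HodgeGroups, §2 (p. 368: "`Hg(E) = SL₂` if `E` is not of CM-type")] [cite: Springer1998, 1.8.2 and 2.2.2 (1)] -/
theorem zdim_map_toGL_hodgeGroupC_eq_three_iff_endAlgRat_eq_bot (Ψ : (Fin 2 → ℝ) ≃L[ℝ] ℂ) :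
    (isZConnected_map_toGL_hodgeGroupC Ψ).zdim = 3 ↔ endAlgRat Ψ = ⊥ := by
  rw [← hodgeGroupC_eq_top_iff_endAlgRat_eq_bot, hodgeGroupC_eq_top_iff_zdim_eq]
  simp

/-- **`dim Hg(E) < 3 ⟺ E` has complex multiplication** (`End_ℚ(E) ≠ ℚ`), for a one-dimensional complex torus.
[cite: Imai1976HodgeGroups, §2 (p. 368)] [cite: Springer1998, 1.8.2] -/
theorem zdim_map_toGL_hodgeGroupC_lt_three_iff_endAlgRat_ne_bot (Ψ : (Fin 2 → ℝ) ≃L[ℝ] ℂ) :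
    (isZConnected_map_toGL_hodgeGroupC Ψ).zdim < 3 ↔ endAlgRat Ψ ≠ ⊥ := by
  rw [Ne, ← zdim_map_toGL_hodgeGroupC_eq_three_iff_endAlgRat_eq_bot]
  have := zdim_map_toGL_hodgeGroupC_le_three Ψ
  omega

/-- **`dim Hg(E_τ) = 3 ⟺ End(E_τ) = ℤ`** for the elliptic curve `E_τ = ℂ/(ℤτ + ℤ)`, `Im τ ≠ 0`.
[cite: Imai1976HodgeGroups, §2 (p. 368)] [cite: Springer1998, 1.8.2 and 2.2.2 (1)] -/
theorem zdim_map_toGL_hodgeGroupC_ellipticPeriod_eq_three_iff {τ : ℂ} (hτ : τ.im ≠ 0) :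
    (isZConnected_map_toGL_hodgeGroupC (ellipticPeriod hτ)).zdim = 3 ↔ ellipticEnd hτ = ⊥ := by
  rw [← hodgeGroupC_ellipticPeriod_eq_top_iff, hodgeGroupC_eq_top_iff_zdim_eq]
  simp

/-- `dim Hg(E_τ) < 3 ⟺ E_τ` has complex multiplication (`End(E_τ) ≠ ℤ`). [cite: Imai1976HodgeGroups, §2 (p. 368)]
[cite: Springer1998, 1.8.2] -/
theorem zdim_map_toGL_hodgeGroupC_ellipticPeriod_lt_three_iff {τ : ℂ} (hτ : τ.im ≠ 0) :
    (isZConnected_map_toGL_hodgeGroupC (ellipticPeriod hτ)).zdim < 3 ↔ ellipticEnd hτ ≠ ⊥ := by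
  rw [Ne, ← zdim_map_toGL_hodgeGroupC_ellipticPeriod_eq_three_iff hτ]
  have := zdim_map_toGL_hodgeGroupC_le_three (ellipticPeriod hτ)
  omega

end DimensionOne

end ComplexTorus

end Literature.Geometry.Kaehler

end
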